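import Summits.BirchSwinnertonDyer.BirchSwinnertonDyer.Theorems.ResidualThetaTransportAtTwoResidualEvenSubgroup
import Summits.BirchSwinnertonDyer.BirchSwinnertonDyer.Theorems.ResidualThetaTransportAtTwoLambdaLowerBoundO
import Literature.NumberTheory.EllipticCurves.TorsionGaloisRepMatrixProofs
import Literature.NumberTheory.EllipticCurves.ModPIrreducibleCongruenceTransferProofs
import Literature.NumberTheory.EllipticCurves.SupersingularDensitySerreTraceProofs
import Literature.NumberTheory.EllipticCurves.SelmerCorankControlRatProofs
import Literature.NumberTheory.EllipticCurves.OrdinaryPrimesProofs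
import Literature.NumberTheory.EllipticCurves.GreenbergSelmerCharIdealPrincipalProofs
import Literature.NumberTheory.EllipticCurves.PadicCoeffIntegersFrobeniusData
import Literature.NumberTheory.EllipticCurves.NewformPadicIntegralModel
import Literature.NumberTheory.GaloisRepresentations.ChebotarevOpenSubgroup
import HarnessLib

/-!
# The residual characteristic polynomials of an integral model of `ρ_{g,ι}` congruent to `W` are those of `W[2] ⊗ k`
# (Chebotarev), and the habitat's trace-one commutator on `W[2]` — arithmetic half of the residual isomorphism
# `A_g[ϖ] ≅ W[2] ⊗ k` of the θ-transport line (crux (R≥)ᵖ, stub `stub_transport` (b))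

Route `ResidualThetaTransportAtTwo` (RTT), crux (R≥)ᵖ `ResidualThetaCountLowerPureAtTwo`
(stmt-BirchSwinnertonDyer-26074), line «bt26-lambda»; seat `prover-bsd-wall-rtt-p2` g12 (`--supports`, closes nothing).
HONEST FRAMING: THEOREMS ONLY (no definition, no named fact, no instance, no `sorry`); nothing about any Selmer group
is asserted; BSD is not proved by any of this.

SETTING (the binders of `stub_thetaDatum` / `stub_transport`). `W/ℚ` globally minimal on the habitat (`GoodSS W 2`,
`Δ_W < 0`); `g ∈ S₂(Γ₀(M))` a newform with an embedding `ι : K_g → ℚ̄₂` and the CONGRUENCE binder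
`‖ι(a_ℓ(g)) − a_ℓ(W)‖ < 1` for all primes `ℓ ∤ 2·M·N_W`; `𝒪 = padicCoeffIntegers (range ι)` (the integers of
`E = ℚ₂(ι K_g)`), `ρ : Γ_ℚ → GL₂(𝒪)` a framed representation unramified with Frobenius polynomial
`X² − ι(a_ℓ)X + ℓ` at every `ℓ ∤ 2M` (the datum of `stub_thetaDatum`), `ϖ ∈ 𝒪` irreducible, `k = 𝒪/ϖ`,
`e : W[2] ≃ 𝔽₂²` a frame (`DokchitserDokchitser2012.rhoMat W e σ ∈ M₂(𝔽₂)` the matrix of `σ` on `W[2]`).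

WHAT.
* §1 (habitat, finite group theory in `GL₂(𝔽₂) ≅ S₃` transported along `permGal`):
  `det_rhoMat_eq_one` (`det ρ̄_{W,2} = 1`), **`exists_trace_rhoMat_commutator_eq_one`** — there are `c, τ ∈ Γ_ℚ` with
  `tr ρ̄_{W,2}(c τ c⁻¹ τ⁻¹) = 1` (`c` a complex conjugation, odd on `W[2]` as `Δ_W < 0`; `τ` an even element acting
  non-trivially, which exists inside `Γ_{ℚ_∞}` on the habitat, `ResidualLayer.exists_even_permGal_ne_one_mem_kerSubgroup`;
  their commutator is a `3`-cycle, whose matrix satisfies `M² + M + 1 = 0`, hence has trace `1`).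
* §2 `norm_lt_one_iff_mem_span` — in `𝒪`, `‖x‖ < 1 ↔ x ∈ (ϖ)`; `isOpen_ker_residual` — the reduction
  `ρ̄ = ρ mod ϖ : Γ_ℚ → GL₂(k)` has open kernel.
* §3 **`charpoly_residual_eq_map_charpoly_rhoMat`** — for EVERY `σ ∈ Γ_ℚ` and every ring map `f : 𝔽₂ → k`:
  `charpoly (ρ̄ σ) = (charpoly (rhoMat W e σ)).map f`. Proof: Chebotarev for the open normal subgroup
  `ker ρ̄ ∩ ker(Γ_ℚ → Aut W[2])` (the tree's PROVED `infinite_setOf_isArithFrobAt_mul_inv_mem`) moves `σ` to an arithmetic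
  Frobenius `φ` at a prime `ℓ ∤ 2·M·N_W·Δ_W`; there `charpoly ρ(φ) = X² − ι(a_ℓ)X + ℓ` (the datum) and on `W[2]`
  `tr = a_ℓ(W)`, `det = ℓ (mod 2)` (tree: `trace_galoisRepTorsion_frobenius_eq`, `det_galoisRepTorsion_frobenius_eq`), and the
  congruence binder puts `ι(a_ℓ) − a_ℓ(W)` in `(ϖ)`.
With the companion `…ThetaTransportResidualNoLine` (no stable line + Brauer–Nesbitt): `ρ̄ ≅ ρ̄_{W,2} ⊗ k` ((b) of `stub_transport`).
References: [DarmonDiamondTaylor1995] Thm. 2.3, Prop. 2.6 (b), 2.8 (a), 2.11 (a); [DeligneSerreASENS1974] 6.7, §8;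
[SerreInventiones1972] §5.3; [SilvermanAEC2009] III.§7, VII.4.1.
-/

set_option autoImplicit false
-- the Theorems namespace of this sub repeats the summit name by design (D-0017 nested layout)
set_option linter.dupNamespace false

noncomputable section

open scoped MatrixGroups
open Matrix Polynomial Equiv WeierstrassCurve NumberField Field IsDedekindDomain
  Literature.NumberTheory.EllipticCurves Literature.NumberTheory.EllipticCurves.DokchitserDokchitser2012
  Literature.NumberTheory.GaloisRepresentations Literature.NumberTheory.EllipticCurves.Rank1Residual
  Rat.HeightOneSpectrum

namespace Summit.BirchSwinnertonDyer.BirchSwinnertonDyer.Theorems.ThetaTransport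

/-! ### §1. Habitat: `det ρ̄_{W,2} = 1` and a trace-one commutator -/

section Habitat

/-- In `S₃`: the commutator of an odd and a non-trivial even permutation is even … [folklore] -/
private theorem perm3_commutator_sign (s t : Perm (Fin 3)) (hs : Perm.sign s = -1) (ht : Perm.sign t = 1)
    (ht1 : t ≠ 1) : Perm.sign (s * t * s⁻¹ * t⁻¹) = 1 := by revert s t; decide

/-- … and non-trivial (a `3`-cycle). [folklore] -/
private theorem perm3_commutator_ne_one (s t : Perm (Fin 3)) (hs : Perm.sign s = -1) (ht : Perm.sign t = 1)
    (ht1 : t ≠ 1) : s * t * s⁻¹ * t⁻¹ ≠ 1 := by revert s t; decide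

/-- In `M₂(𝔽₂)`: `M² + M + 1 = 0` forces `tr M = 1`. [folklore] -/
private theorem trace_eq_one_of_sq_add_eq_zero (A : Matrix (Fin 2) (Fin 2) (ZMod 2)) (h : A * A + A + 1 = 0) :
    A.trace = 1 := by
  revert A; decide

/-- In `𝔽₂`: `a b = 1` forces `a = 1`. [folklore] -/
private theorem zmod_two_eq_one_of_mul_eq_one (a b : ZMod 2) (h : a * b = 1) : a = 1 := by
  revert a b; decide

variable (W : WeierstrassCurve ℚ)

/-- **`det ρ̄_{W,2}(σ) = 1`** for every `σ ∈ Γ_ℚ` (every unit of `𝔽₂` is `1`). [cite: SilvermanAEC2009, III.§7] -/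
theorem det_rhoMat_eq_one (e : geomTorsion W 2 ≃+ (Fin 2 → ZMod 2)) (σ : absoluteGaloisGroup ℚ) :
    (rhoMat W e σ).det = 1 := by
  refine zmod_two_eq_one_of_mul_eq_one _ (rhoMat W e σ⁻¹).det ?_
  rw [← Matrix.det_mul, ← map_mul, mul_inv_cancel, map_one, Matrix.det_one]

variable [W.IsElliptic]

/-- `permGal` of an inverse. [cite: SilvermanAEC2009, III.§7] -/
theorem permGal_inv (h2 : (2 : ℚ) ≠ 0) (σ : absoluteGaloisGroup ℚ) : permGal W h2 σ⁻¹ = (permGal W h2 σ)⁻¹ :=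
  eq_inv_of_mul_eq_one_left (by rw [← permGal_mul, inv_mul_cancel, permGal_one])

/-- An even `u ∈ Γ_ℚ` acting non-trivially on `W[2]` has a matrix `A` with `A² + A + 1 = 0`, hence `tr A = 1`.
[cite: SilvermanAEC2009, III.§7] -/
theorem trace_rhoMat_eq_one_of_even_ne_one (h2 : (2 : ℚ) ≠ 0) (e : geomTorsion W 2 ≃+ (Fin 2 → ZMod 2))
    {u : absoluteGaloisGroup ℚ} (hu : Perm.sign (permGal W h2 u) = 1) (hu1 : permGal W h2 u ≠ 1) :
    (rhoMat W e u).trace = 1 := by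
  apply trace_eq_one_of_sq_add_eq_zero
  ext i j
  -- test against the frame vectors: `(A² + A + 1) (e P) = e (u•u•P + u•P + P) = 0`
  have hcol : ∀ v : Fin 2 → ZMod 2, (rhoMat W e u * rhoMat W e u + rhoMat W e u + 1) *ᵥ v = 0 := by
    intro v
    obtain ⟨P, rfl⟩ := e.surjective v
    rw [Matrix.add_mulVec, Matrix.add_mulVec, Matrix.one_mulVec, ← Matrix.mulVec_mulVec, ← rhoMat_mulVec,
      ← rhoMat_mulVec, ← map_add, ← map_add,
      ResidualLayer.smul_smul_add_of_even_ne_one W h2 hu hu1 P, map_zero]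
  have := congr_fun (hcol (Pi.single j 1)) i
  simpa [Matrix.mulVec, dotProduct, Pi.single_apply, Fin.sum_univ_two] using this

variable [W.IsGloballyMinimal]

/-- **A trace-one commutator on `W[2]` on the habitat**: for `W` globally minimal with good supersingular reduction at `2`
and `Δ_W < 0` there are `c, τ ∈ Γ_ℚ` with `tr ρ̄_{W,2}(c τ c⁻¹ τ⁻¹) = 1` (`c` a complex conjugation — odd on `W[2]`;
`τ` even and non-trivial on `W[2]` — exists inside `Γ_{ℚ_∞}` for any `ℤ₂`-extension; the commutator is a `3`-cycle).
[cite: SerreInventiones1972, §5.3] [cite: SilvermanAEC2009, III.§7] -/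
theorem exists_trace_rhoMat_commutator_eq_one (hss : GoodSS W 2) (hΔ : W.Δ < 0) (κ : ZpExtension ℚ 2)
    (e : geomTorsion W 2 ≃+ (Fin 2 → ZMod 2)) :
    ∃ c τ : absoluteGaloisGroup ℚ, (rhoMat W e (c * τ * c⁻¹ * τ⁻¹)).trace = 1 := by
  have h2 : (2 : ℚ) ≠ 0 := by norm_num
  obtain ⟨τ, -, hτ, hτ1⟩ := ResidualLayer.exists_even_permGal_ne_one_mem_kerSubgroup W h2 hss κ
  let w : InfinitePlace ℚ := Classical.arbitrary _
  have hcard := SignedTransportAtTwo.natCard_absoluteGaloisGroup_completion w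
  obtain ⟨c₀, hc₀⟩ : ∃ c₀ : absoluteGaloisGroup w.Completion, c₀ ≠ 1 := by
    by_contra h
    push Not at h
    haveI : Subsingleton (absoluteGaloisGroup w.Completion) := ⟨fun a b ↦ by rw [h a, h b]⟩
    have := Nat.card_of_subsingleton (1 : absoluteGaloisGroup w.Completion)
    omega
  have hc := ResidualLayer.sign_permGal_resGal_eq_neg_one_of_Δ_neg W h2 hΔ w hc₀
  set c := resGal (K := ℚ) w.Completion c₀
  refine ⟨c, τ, trace_rhoMat_eq_one_of_even_ne_one W h2 e ?_ ?_⟩ <;>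
    rw [permGal_mul, permGal_mul, permGal_mul, permGal_inv, permGal_inv]
  · exact perm3_commutator_sign _ _ hc hτ hτ1
  · exact perm3_commutator_ne_one _ _ hc hτ hτ1

end Habitat

/-! ### §2. The coefficient ring `𝒪`: `‖x‖ < 1 ⇒ x ∈ (ϖ)`; the reduction `ρ mod ϖ` has open kernel -/

section Ring

variable {S : Set (PadicAlgCl 2)}

/-- A unit of `𝒪 = padicCoeffIntegers S` has norm `1` (both `u` and `u⁻¹` lie in the unit ball). [folklore] -/
theorem norm_coe_eq_one_of_isUnit {u : ↥(padicCoeffIntegers S)} (hu : IsUnit u) :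
    ‖((u : ↥(padicCoeffIntegers S)) : PadicAlgCl 2)‖ = 1 := by
  obtain ⟨u, rfl⟩ := hu
  have h1 : ‖((u : ↥(padicCoeffIntegers S)) : PadicAlgCl 2)‖ *
      ‖(((u⁻¹ : (↥(padicCoeffIntegers S))ˣ) : ↥(padicCoeffIntegers S)) : PadicAlgCl 2)‖ = 1 := by
    rw [← norm_mul, ← Subring.coe_mul, ← Units.val_mul, mul_inv_cancel, Units.val_one, OneMemClass.coe_one,
      norm_one]
  have hle₁ : ‖((u : ↥(padicCoeffIntegers S)) : PadicAlgCl 2)‖ ≤ 1 := (u : ↥(padicCoeffIntegers S)).2.2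
  have hle₂ : ‖(((u⁻¹ : (↥(padicCoeffIntegers S))ˣ) : ↥(padicCoeffIntegers S)) : PadicAlgCl 2)‖ ≤ 1 :=
    ((u⁻¹ : (↥(padicCoeffIntegers S))ˣ) : ↥(padicCoeffIntegers S)).2.2
  refine le_antisymm hle₁ (not_lt.mp fun hlt ↦ ?_)
  have := mul_lt_one_of_nonneg_of_lt_one_left (norm_nonneg _) hlt hle₂
  linarith

/-- In `𝒪` (a local ring with uniformiser `ϖ`), **an element of norm `< 1` lies in `(ϖ)`** (it is a non-unit, and the
maximal ideal is `(ϖ)`). [cite: NeukirchANT1999, Ch. II (4.8)] -/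
theorem mem_span_of_norm_lt_one [IsDiscreteValuationRing ↥(padicCoeffIntegers S)]
    {ϖ : ↥(padicCoeffIntegers S)} (hϖ : Irreducible ϖ) {x : ↥(padicCoeffIntegers S)}
    (hx : ‖(x : PadicAlgCl 2)‖ < 1) : x ∈ Ideal.span {ϖ} := by
  rw [← (IsDiscreteValuationRing.irreducible_iff_uniformizer ϖ).mp hϖ, IsLocalRing.mem_maximalIdeal,
    mem_nonunits_iff]
  intro hu
  have := norm_coe_eq_one_of_isUnit hu
  linarith

/-- **The reduction `ρ mod ϖ : G → GL_n(𝒪/ϖ)` of a continuous `ρ : G → GL_n(𝒪)` has open kernel**: it contains the open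
neighbourhood `{σ | ‖ρ(σ)_{ij} − δ_{ij}‖ < 1 ∀ i j}` of `1`. [cite: DeligneSerreASENS1974, 6.12] -/
theorem isOpen_ker_residual [IsDiscreteValuationRing ↥(padicCoeffIntegers S)] {G : Type*} [Group G]
    [TopologicalSpace G] [IsTopologicalGroup G] {n : ℕ} (ρ : G →ₜ* GL (Fin n) ↥(padicCoeffIntegers S))
    {ϖ : ↥(padicCoeffIntegers S)} (hϖ : Irreducible ϖ) :
    IsOpen ((((Matrix.GeneralLinearGroup.map (Ideal.Quotient.mk (Ideal.span {ϖ}))).comp ρ.toMonoidHom).ker :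
      Subgroup G) : Set G) := by
  let V : Set G := {σ | ∀ i j : Fin n,
    ‖((((ρ σ : GL (Fin n) ↥(padicCoeffIntegers S)) : Matrix (Fin n) (Fin n) ↥(padicCoeffIntegers S)) i j - (1 : Matrix (Fin n) (Fin n) ↥(padicCoeffIntegers S)) i j : ↥(padicCoeffIntegers S)) :
      PadicAlgCl 2)‖ < 1}
  have hVopen : IsOpen V := by
    have hV : V = ⋂ i : Fin n, ⋂ j : Fin n, {σ | ‖((((ρ σ : GL (Fin n) ↥(padicCoeffIntegers S)) : Matrix (Fin n) (Fin n) ↥(padicCoeffIntegers S)) i j -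
        (1 : Matrix (Fin n) (Fin n) ↥(padicCoeffIntegers S)) i j : ↥(padicCoeffIntegers S)) : PadicAlgCl 2)‖ < 1} := by
      ext σ; simp [V]
    rw [hV]
    refine isOpen_iInter_of_finite fun i ↦ isOpen_iInter_of_finite fun j ↦ ?_
    have hcont : Continuous fun σ : G ↦ ((((ρ σ : GL (Fin n) ↥(padicCoeffIntegers S)) : Matrix (Fin n) (Fin n) ↥(padicCoeffIntegers S)) i j -
        (1 : Matrix (Fin n) (Fin n) ↥(padicCoeffIntegers S)) i j : ↥(padicCoeffIntegers S)) : PadicAlgCl 2) := by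
      have h0 : Continuous fun σ : G ↦ ((ρ σ : GL (Fin n) ↥(padicCoeffIntegers S)) :
          Matrix (Fin n) (Fin n) ↥(padicCoeffIntegers S)) := Units.continuous_val.comp (map_continuous ρ)
      exact continuous_subtype_val.comp ((h0.matrix_elem i j).sub continuous_const)
    exact isOpen_lt (continuous_norm.comp hcont) continuous_const
  have h1V : (1 : G) ∈ V := by
    intro i j
    simp [map_one]
  have hVker : V ⊆ ((((Matrix.GeneralLinearGroup.map (Ideal.Quotient.mk (Ideal.span {ϖ}))).comp
      ρ.toMonoidHom).ker : Subgroup G) : Set G) := by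
    intro σ hσ
    rw [SetLike.mem_coe, MonoidHom.mem_ker]
    ext i j
    change Ideal.Quotient.mk (Ideal.span {ϖ}) (((ρ σ : GL (Fin n) ↥(padicCoeffIntegers S)) : Matrix (Fin n) (Fin n) ↥(padicCoeffIntegers S)) i j) =
      (1 : Matrix (Fin n) (Fin n) (↥(padicCoeffIntegers S) ⧸ Ideal.span {ϖ})) i j
    have hmem := mem_span_of_norm_lt_one hϖ (hσ i j)
    rw [← Matrix.map_one (Ideal.Quotient.mk (Ideal.span {ϖ})) (map_zero _) (map_one _), Matrix.map_apply,
      Ideal.Quotient.eq]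
    exact hmem
  exact Subgroup.isOpen_of_mem_nhds _ (Filter.mem_of_superset (hVopen.mem_nhds h1V) hVker)

end Ring

/-! ### §3. The residual characteristic polynomials of `ρ` are those of `W[2] ⊗ k` (Chebotarev) -/

section Charpoly

variable (W : WeierstrassCurve ℚ) [W.IsElliptic] [W.IsGloballyMinimal]

omit [W.IsElliptic] [W.IsGloballyMinimal] in
/-- The matrix `rhoMat W e σ` is the matrix of the `𝔽₂`-linear map `ρ̄_{W,2}(σ)` in the basis `e⁻¹(δ₀), e⁻¹(δ₁)`; hence its
trace and determinant are those of that linear map. [cite: SilvermanAEC2009, III.§7] -/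
theorem trace_rhoMat_eq_and_det_rhoMat_eq (e : geomTorsion W 2 ≃+ (Fin 2 → ZMod 2)) (σ : absoluteGaloisGroup ℚ) :
    letI : Module (ZMod 2) (geomTorsion W 2) := AddSubgroup.torsionBy.zmodModule
    (rhoMat W e σ).trace = LinearMap.trace (ZMod 2) (geomTorsion W 2)
        ((galoisRepTorsion W 2 σ).toAdd.toAddMonoidHom.toZModLinearMap 2) ∧
      (rhoMat W e σ).det = LinearMap.det ((galoisRepTorsion W 2 σ).toAdd.toAddMonoidHom.toZModLinearMap 2) := by
  letI : Module (ZMod 2) (geomTorsion W 2) := AddSubgroup.torsionBy.zmodModule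
  let eₗ : geomTorsion W 2 ≃ₗ[ZMod 2] (Fin 2 → ZMod 2) :=
    { e.toAddMonoidHom.toZModLinearMap 2 with
      invFun := e.symm
      left_inv := e.left_inv
      right_inv := e.right_inv }
  let b := Module.Basis.ofEquivFun eₗ
  set L := (galoisRepTorsion W 2 σ).toAdd.toAddMonoidHom.toZModLinearMap 2 with hL
  have hLapply : ∀ P, L P = σ • P := fun _ ↦ rfl
  have hrepr : ∀ P, ⇑(b.repr P) = e P := fun P ↦ funext fun i ↦ Module.Basis.ofEquivFun_repr_apply eₗ P i
  have hmat : LinearMap.toMatrix b b L = rhoMat W e σ := by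
    refine Matrix.toLin'.injective (LinearMap.ext fun v ↦ ?_)
    obtain ⟨P, rfl⟩ := e.surjective v
    rw [Matrix.toLin'_apply, Matrix.toLin'_apply, ← rhoMat_mulVec, ← hLapply, ← hrepr, ← hrepr (L P),
      LinearMap.toMatrix_mulVec_repr]
  refine ⟨?_, ?_⟩
  · rw [LinearMap.trace_eq_matrix_trace (ZMod 2) b, hmat]
  · rw [← LinearMap.det_toMatrix b, hmat]

set_option maxHeartbeats 400000 in
/-- **The residual characteristic polynomials of an integral model of `ρ_{g,ι}` congruent to `W` are those of
`W[2] ⊗ k`.** Let `g ∈ S₂(Γ₀(M))` be a newform, `ι : K_g → ℚ̄₂`, with `‖ι(a_ℓ(g)) − a_ℓ(W)‖ < 1` for all primes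
`ℓ ∤ 2·M·N_W`; let `ρ : Γ_ℚ → GL₂(𝒪)` (`𝒪 = padicCoeffIntegers (range ι)`) be unramified with Frobenius polynomial
`X² − ι(a_ℓ)X + ℓ` at every `ℓ ∤ 2M`; let `ϖ ∈ 𝒪` be irreducible and `f : 𝔽₂ → 𝒪/ϖ` a ring map. Then for EVERY
`σ ∈ Γ_ℚ`, `charpoly(ρ(σ) mod ϖ) = charpoly(ρ̄_{W,2}(σ)) ⊗_f (𝒪/ϖ)`. Chebotarev (tree, PROVED:
`exists_isArithFrobAt_mul_inv_mem_not_mem`) for the open normal subgroup `ker(ρ mod ϖ) ∩ ker(Γ_ℚ → Aut W[2])` replaces `σ`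
by an arithmetic Frobenius at a prime `ℓ ∤ 2·M·N_W·Δ_W`, where both sides are `X² − a_ℓ X + ℓ` reduced
(`trace_galoisRepTorsion_frobenius_eq`, `det_galoisRepTorsion_frobenius_eq`, and the congruence binder).
[cite: DarmonDiamondTaylor1995, Thm. 2.3, Prop. 2.6 (b), Prop. 2.8 (a), Prop. 2.11 (a) (PDF pp. 52–57)]
[cite: DeligneSerreASENS1974, 6.7 and §8.6] -/
theorem charpoly_residual_eq_map_charpoly_rhoMat {M : ℕ} [NeZero M]
    (g : CuspForm (CongruenceSubgroup.Gamma0 M) 2) (ι : ModularForms.coeffField g →+* PadicAlgCl 2)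
    (hnew : ModularForms.IsNewform0 g)
    (hcong : ∀ ℓ : ℕ, ℓ.Prime → ¬ ℓ ∣ 2 * M * W.conductorNorm ℤ →
      ‖embCoeff g ι ℓ - (W.frobeniusTrace ℓ : PadicAlgCl 2)‖ < 1)
    (ρ : FramedGaloisRep ℚ ↥(padicCoeffIntegers (Set.range ι)) 2)
    (hρ : ∀ v : HeightOneSpectrum (𝓞 ℚ), ¬ natGenerator v ∣ 2 * M →
      FramedGaloisRep.IsUnramifiedAt v ρ ∧ ∃ P : Polynomial ↥(padicCoeffIntegers (Set.range ι)),
        P.map (padicCoeffIntegers (Set.range ι)).subtype =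
          X ^ 2 - C (embCoeff g ι (natGenerator v)) * X + C ((natGenerator v : ℕ) : PadicAlgCl 2) ∧
        FramedGaloisRep.HasFrobCharpolyAt v P ρ)
    (ϖ : ↥(padicCoeffIntegers (Set.range ι))) (hϖ : Irreducible ϖ)
    (e : geomTorsion W 2 ≃+ (Fin 2 → ZMod 2))
    (f : ZMod 2 →+* (↥(padicCoeffIntegers (Set.range ι)) ⧸ Ideal.span {ϖ})) (σ : absoluteGaloisGroup ℚ) :
    (((ρ σ : GL (Fin 2) ↥(padicCoeffIntegers (Set.range ι))) :
        Matrix (Fin 2) (Fin 2) ↥(padicCoeffIntegers (Set.range ι))).map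
        (Ideal.Quotient.mk (Ideal.span {ϖ}))).charpoly = ((rhoMat W e σ).charpoly).map f := by
  -- the coefficient ring `𝒪` is a discrete valuation ring
  haveI : FiniteDimensional ℚ (ModularForms.coeffField g) :=
    ModularForms.IsNewform0.finiteDimensional_coeffField_holds hnew
  haveI : FiniteDimensional ℚ_[2] ↥(padicCoeffField (Set.range ι)) :=
    GreenbergSelmer.finiteDimensional_padicCoeffField ι
  haveI hdvr : IsDiscreteValuationRing ↥(padicCoeffIntegers (Set.range ι)) := by
    rw [padicCoeffIntegers_eq_unitBall]
    exact LambdaLowerBoundO.isDiscreteValuationRing_unitBall 2 _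
  -- the reduction `ρ̄` and the open normal subgroup `N = ker ρ̄ ∩ ker (Γ_ℚ → Aut W[2])`
  let ρbar : absoluteGaloisGroup ℚ →* GL (Fin 2) (↥(padicCoeffIntegers (Set.range ι)) ⧸ Ideal.span {ϖ}) :=
    (Matrix.GeneralLinearGroup.map (Ideal.Quotient.mk (Ideal.span {ϖ}))).comp ρ.toMonoidHom
  have hρbar : ∀ τ, ((ρbar τ : GL (Fin 2) (↥(padicCoeffIntegers (Set.range ι)) ⧸ Ideal.span {ϖ})) : Matrix (Fin 2) (Fin 2) _) =
      (((ρ τ : GL (Fin 2) ↥(padicCoeffIntegers (Set.range ι))) : Matrix (Fin 2) (Fin 2) ↥(padicCoeffIntegers (Set.range ι)))).map (Ideal.Quotient.mk (Ideal.span {ϖ})) := fun _ ↦ rfl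
  let aW : absoluteGaloisGroup ℚ →* Perm (geomTorsion W 2) := MulAction.toPermHom _ _
  let N : Subgroup (absoluteGaloisGroup ℚ) := ρbar.ker ⊓ aW.ker
  haveI : N.Normal := Subgroup.normal_inf_normal _ _
  have hNopen : IsOpen (N : Set (absoluteGaloisGroup ℚ)) := by
    rw [Subgroup.coe_inf]
    refine (isOpen_ker_residual ρ hϖ).inter ?_
    haveI : Finite (geomTorsion W 2) := finite_torsionPoints_holds W (AlgebraicClosure ℚ) (n := 2) (by norm_num)
    have hker : (aW.ker : Set (absoluteGaloisGroup ℚ)) =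
        ⋂ P : geomTorsion W 2, (MulAction.stabilizer (absoluteGaloisGroup ℚ) (P : W.geomPoints) : Set _) := by
      ext τ
      simp only [SetLike.mem_coe, MonoidHom.mem_ker, Set.mem_iInter, MulAction.mem_stabilizer_iff]
      constructor
      · intro h P
        have hP := Equiv.congr_fun h P
        rw [MulAction.toPermHom_apply, MulAction.toPerm_apply, Equiv.Perm.one_apply] at hP
        have hP' := congrArg Subtype.val hP
        rwa [AddSubgroup.torsionBy.coe_smul] at hP'
      · intro h
        ext P
        rw [MulAction.toPermHom_apply, MulAction.toPerm_apply, Equiv.Perm.one_apply,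
          AddSubgroup.torsionBy.coe_smul]
        exact h P
    rw [hker]
    exact isOpen_iInter_of_finite fun P ↦ isOpen_stabilizer_point_holds W (P : W.geomPoints)
  -- the finite set of excluded places: those above a prime dividing `2·M·N_W·Δ_W`
  have hNW : W.conductorNorm ℤ ≠ 0 := (W.conductorNorm_pos_holds).ne'
  have hΔ0 : (minimalDiscriminantInt W).natAbs ≠ 0 := Int.natAbs_ne_zero.mpr (minimalDiscriminantInt_ne_zero W)
  set m₀ : ℕ := 2 * M * W.conductorNorm ℤ * (minimalDiscriminantInt W).natAbs with hm₀
  have hm₀0 : m₀ ≠ 0 := by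
    have : (M : ℕ) ≠ 0 := NeZero.ne M
    positivity
  set T : Set ℕ := ↑(Nat.divisors m₀) with hT
  have hTfin : T.Finite := (Nat.divisors m₀).finite_toSet
  obtain ⟨v, hvB, -, 𝔓, h𝔓, φ, hφ, hφσ⟩ :=
    exists_isArithFrobAt_mul_inv_mem_not_mem ℚ N hNopen σ _ (finite_setOf_place_over T hTfin)
  -- the residue characteristic `ℓ` of `v`
  set ℓ : ℕ := natGenerator v with hℓdef
  have hℓ : ℓ.Prime := prime_natGenerator v
  haveI : Fact ℓ.Prime := ⟨hℓ⟩
  have hℓv : (ℓ : 𝓞 ℚ) ∈ v.asIdeal := Rat.HeightOneSpectrum.natCast_natGenerator_mem v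
  have hℓT : ℓ ∉ T := fun h ↦ hvB (Set.mem_biUnion (x := ℓ) ⟨h, hℓ.ne_zero⟩ hℓv)
  have hℓm₀ : ¬ ℓ ∣ m₀ := fun h ↦ hℓT (by rw [hT, Finset.mem_coe, Nat.mem_divisors]; exact ⟨h, hm₀0⟩)
  have hℓ2MN : ¬ ℓ ∣ 2 * M * W.conductorNorm ℤ := fun h ↦ hℓm₀ (h.mul_right _)
  have hℓ2M : ¬ ℓ ∣ 2 * M := fun h ↦ hℓ2MN (h.mul_right _)
  have hℓ2 : ℓ ≠ 2 := by
    rintro h2; exact hℓ2M (h2 ▸ dvd_mul_right 2 M)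
  have hℓΔ : ¬ (ℓ : ℤ) ∣ minimalDiscriminantInt W := fun h ↦
    hℓm₀ ((Int.natCast_dvd.mp (Int.dvd_natAbs.mpr h)).mul_left _)
  have hgood : W.HasGoodReductionAtPrime ℓ := hasGoodReductionAtPrime_of_not_dvd W ℓ hℓΔ
  have hvℓ : (primesEquiv v : ℕ) = ℓ := rfl
  -- `φ ≡ σ` on both sides
  have hφσ₁ : ρbar φ = ρbar σ := by
    have h := (Subgroup.mem_inf.mp hφσ).1
    rw [MonoidHom.mem_ker, map_mul, map_inv, mul_inv_eq_one] at h
    exact h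
  have hφσ₂ : rhoMat W e φ = rhoMat W e σ := by
    have h := (Subgroup.mem_inf.mp hφσ).2
    rw [MonoidHom.mem_ker] at h
    have hfix : ∀ P : geomTorsion W 2, (φ * σ⁻¹) • P = P := fun P ↦ by
      have hP := Equiv.congr_fun h P
      rwa [MulAction.toPermHom_apply, MulAction.toPerm_apply, Equiv.Perm.one_apply] at hP
    have h1 : rhoMat W e (φ * σ⁻¹) = 1 := by
      rw [rhoMat_apply]
      exact repMatrix_eq_one_of e _ fun P ↦ by rw [galoisRepTorsion_apply]; exact hfix P
    calc rhoMat W e φ = rhoMat W e (φ * σ⁻¹ * σ) := by rw [inv_mul_cancel_right]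
      _ = rhoMat W e σ := by rw [map_mul, h1, one_mul]
  -- the `g`-side at `φ`: `charpoly ρ(φ) = X² − a₀X + ℓ`, `a₀ = ι(a_ℓ(g))`
  obtain ⟨-, P, hPmap, hPfrob⟩ := hρ v hℓ2M
  have hcpP : (((ρ φ : GL (Fin 2) ↥(padicCoeffIntegers (Set.range ι))) :
      Matrix (Fin 2) (Fin 2) ↥(padicCoeffIntegers (Set.range ι)))).charpoly = P := hPfrob 𝔓 h𝔓 φ hφ
  set a₀ : ↥(padicCoeffIntegers (Set.range ι)) := -P.coeff 1 with ha₀def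
  have ha₀ : (a₀ : PadicAlgCl 2) = embCoeff g ι ℓ := by
    have h := congrArg (fun Q : Polynomial (PadicAlgCl 2) ↦ Q.coeff 1) hPmap
    simp only [Polynomial.coeff_map, Subring.coe_subtype] at h
    rw [ha₀def, Subring.coe_neg, h, hℓdef]
    simp [Polynomial.coeff_C, Polynomial.coeff_X_pow]
  have hPeq : P = X ^ 2 - C a₀ * X + C ((ℓ : ℕ) : ↥(padicCoeffIntegers (Set.range ι))) := by
    apply Polynomial.map_injective (padicCoeffIntegers (Set.range ι)).subtype Subtype.val_injective
    rw [hPmap, hℓdef]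
    simp only [Polynomial.map_add, Polynomial.map_sub, Polynomial.map_mul, Polynomial.map_pow, Polynomial.map_X,
      Polynomial.map_C, Subring.coe_subtype, ha₀, Subring.coe_natCast, hℓdef]
  -- the congruence binder: `a₀ ≡ a_ℓ(W)` modulo `ϖ`
  have hcongr : Ideal.Quotient.mk (Ideal.span {ϖ}) a₀ = f ((W.frobeniusTrace ℓ : ℤ) : ZMod 2) := by
    rw [map_intCast, ← map_intCast (Ideal.Quotient.mk (Ideal.span {ϖ})), Ideal.Quotient.eq]
    apply mem_span_of_norm_lt_one hϖ
    rw [AddSubgroupClass.coe_sub, ha₀, Subring.coe_intCast]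
    exact hcong ℓ hℓ hℓ2MN
  have hℓcast : Ideal.Quotient.mk (Ideal.span {ϖ}) ((ℓ : ℕ) : ↥(padicCoeffIntegers (Set.range ι))) =
      f ((ℓ : ℕ) : ZMod 2) := by
    rw [map_natCast, map_natCast]
  -- the `W`-side at `φ`: `tr = a_ℓ(W)`, `det = ℓ` on `W[2]`
  letI : Module (ZMod 2) (geomTorsion W 2) := AddSubgroup.torsionBy.zmodModule
  haveI : Fact (Nat.Prime 2) := ⟨Nat.prime_two⟩
  obtain ⟨htr, hdet⟩ := trace_rhoMat_eq_and_det_rhoMat_eq W e φ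
  have htrW : (rhoMat W e φ).trace = ((W.frobeniusTrace ℓ : ℤ) : ZMod 2) := by
    rw [htr]; exact W.trace_galoisRepTorsion_frobenius_eq 2 hℓ2 hgood hvℓ h𝔓 hφ
  have hdetW : (rhoMat W e φ).det = ((ℓ : ℕ) : ZMod 2) := by
    rw [hdet]; exact W.det_galoisRepTorsion_frobenius_eq 2 hℓ2 hgood hvℓ h𝔓 hφ
  -- assemble
  rw [← hρbar, ← hφσ₁, hρbar, Matrix.charpoly_map, hcpP, hPeq, ← hφσ₂, Matrix.charpoly_fin_two, htrW, hdetW]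
  simp only [Polynomial.map_add, Polynomial.map_sub, Polynomial.map_mul, Polynomial.map_pow, Polynomial.map_X,
    Polynomial.map_C, hcongr, hℓcast]

end Charpoly

end Summit.BirchSwinnertonDyer.BirchSwinnertonDyer.Theorems.ThetaTransport

end
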